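import Literature.Analysis.FluidPDE.EmpiricalCollisionMeasureMeasurable
import Literature.MathematicalPhysics.KineticTheory.HardSphereEuler
import HarnessLib

/-!
# Collision windows: bookkeeping and measurability of the collision count
# (helpers toward the rung-0 collision-count bound; crux `JParityClosure.OddContactSymmetry`,
# stmt-AtomisticToContinuum-13078, line `equilibrium-rung-mean-variance`, transfer debt "tightness")

Lead prover r-1 of the crux.  The repaired crux (bounded balance-exact weight, C′₃) and the route's
support item `CollisionTightness` (stmt-13085) both reduce, at rung 0 (constant profiles, invariant
Gibbs law), to a FIRST-MOMENT bound on the number of collisions of the hard-sphere flow in a time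
window, `E_{G_N}[numCollisions[0,τ]] ≤ C τ σ² √θ (N+1)^{4/3}`, proved by chopping `[0, τ]` into short
windows, invariance, and static estimates of the one- and two-collision window events.  This file
holds the flow-side bookkeeping used by that argument, for an ABSTRACT `HardSphereFlow`:

* `exists_window_of_mem_Icc`, `numCollisions_le_sum_windows` — window subadditivity of the count;
* `min_le_sum_min`, `min_le_indicator_add` — the truncation arithmetic `min(n, M)`;
* `numCollisions_flow_shift` — the count of the orbit of `Φ_t z` in `[a, b]` is the count of the
  orbit of `z` in `[a + t, b + t]` (group property on the good set);
* `collisionSum_one_real_eq`, `measurable_indicator_numCollisions` — the count, extended by `0` off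
  the good set, is measurable in the initial datum (from
  `HardSphereFlow.measurable_indicator_collisionSum_Icc` and `collisionSum 1 = 2·numCollisions`).

References: Gallagher–Saint-Raymond–Texier 2013, Prop. 4.1.1 (finitely many collisions in finite
time on the good set); Cercignani–Illner–Pulvirenti 1994, App. 4.A.
-/

noncomputable section

open MeasureTheory Set Filter Topology
open scoped ENNReal BigOperators

namespace Summit.AtomisticToContinuum.HydrodynamicLimit.Theorems

open Literature.Analysis.FluidPDE Literature.MathematicalPhysics.KineticTheory

/-- On a hard-sphere trajectory in a regular geometry, the real-valued collision sum of the constant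
mark `1` over `[a, b]` is twice the number of collisions. [folklore] -/
theorem collisionSum_one_real_eq {d : Type*} [Fintype d] {X : Type*} [TopologicalSpace X] {N : ℕ}
    {G : Geometry d X} {ε : ℝ} {γ : ℝ → Config N d X} (h : IsHardSphereTrajectory G ε N γ)
    (hG : G.IsHardSphereRegular ε) (a b : ℝ) :
    collisionSum G ε γ (Icc a b) (fun _ => (1 : ℝ)) = 2 * (numCollisions G ε γ a b : ℝ) := by
  have hfin := h.locFinite a b
  have hnat := h.collisionSum_one_eq_two_mul_numCollisions hG a b
  rw [collisionSum_eq_finset_sum hfin] at hnat ⊢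
  have hcast : ((∑ t ∈ hfin.toFinset, ∑ p ∈ contactPairs G ε (γ t), (1 : ℕ) : ℕ) : ℝ) =
      ∑ t ∈ hfin.toFinset, ∑ p ∈ contactPairs G ε (γ t), (1 : ℝ) := by
    push_cast
    rfl
  rw [← hcast, hnat]
  push_cast
  ring

/-- **The collision count is measurable in the initial datum** (extended by `0` off the good set):
for every hard-sphere flow `Φ` of `N` spheres of diameter `0 < ε < 1/2` on the flat torus `𝕋³` and
every window `[a, b]`, `z ↦ 𝟙_good(z) · numCollisions[a, b](orbit of z)` is measurable with values in
`ℝ≥0∞` (from the measurability of collision sums, `HardSphereFlow.measurable_indicator_collisionSum_Icc`,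
and `collisionSum 1 = 2 · numCollisions`). [folklore] -/
theorem measurable_indicator_numCollisions {N : ℕ} {ε : ℝ} (hε2 : ε < 2⁻¹)
    (Φ : HardSphereFlow (Torus.geometry (Fin 3)) ε N) (a b : ℝ) :
    Measurable (Φ.good.indicator fun z =>
      (numCollisions (Torus.geometry (Fin 3)) ε (fun s => Φ.flow s z) a b : ℝ≥0∞)) := by
  have hG := Torus.isHardSphereRegular_geometry (d := Fin 3) hε2
  have hGm := Torus.isMeasurable_geometry (d := Fin 3)
  have hS : Measurable (Φ.good.indicator fun z => Φ.collisionSum (Icc a b) (fun _ => (1 : ℝ)) z) :=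
    Φ.measurable_indicator_collisionSum_Icc hG hGm (f := fun _ => (1 : ℝ)) continuous_const
      measurable_const a b
  have heq : (Φ.good.indicator fun z =>
      (numCollisions (Torus.geometry (Fin 3)) ε (fun s => Φ.flow s z) a b : ℝ≥0∞)) =
      fun z => ENNReal.ofReal ((Φ.good.indicator fun z =>
        Φ.collisionSum (Icc a b) (fun _ => (1 : ℝ)) z) z / 2) := by
    funext z
    by_cases hz : z ∈ Φ.good
    · rw [indicator_of_mem hz, indicator_of_mem hz, HardSphereFlow.collisionSum_eq,
        collisionSum_one_real_eq (Φ.isTrajectory z hz) hG a b, mul_div_cancel_left₀ _ two_ne_zero,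
        ENNReal.ofReal_natCast]
    · rw [indicator_of_notMem hz, indicator_of_notMem hz, zero_div, ENNReal.ofReal_zero]
  rw [heq]
  exact (hS.div_const 2).ennreal_ofReal


variable {d : Type*} [Fintype d] {X : Type*} {N : ℕ} {G : Geometry d X} {ε : ℝ}

/-- Every time of `[a, a + m δ]` (`m ≥ 1`, `δ ≥ 0`) lies in one of the `m` windows
`[a + k δ, a + (k+1) δ]`, `k < m`. [folklore] -/
theorem exists_window_of_mem_Icc {a δ t : ℝ} (hδ : 0 ≤ δ) {m : ℕ} (hm : 0 < m)
    (ht : t ∈ Icc a (a + m * δ)) :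
    ∃ k : ℕ, k < m ∧ t ∈ Icc (a + k * δ) (a + (k + 1) * δ) := by
  obtain ⟨hta, htb⟩ := ht
  rcases eq_or_lt_of_le hδ with hδ0 | hδpos
  · refine ⟨0, hm, ?_, ?_⟩
    · simpa using hta
    · rw [← hδ0] at htb ⊢
      simpa using htb
  · set k₀ := ⌊(t - a) / δ⌋₊ with hk₀
    have hnonneg : 0 ≤ (t - a) / δ := div_nonneg (by linarith) hδpos.le
    refine ⟨min (m - 1) k₀, ?_, ?_, ?_⟩
    · exact (min_le_left _ _).trans_lt (Nat.sub_lt hm one_pos)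
    · -- lower end: `a + k δ ≤ t` since `k ≤ k₀ ≤ (t - a)/δ`
      have hk : ((min (m - 1) k₀ : ℕ) : ℝ) ≤ (t - a) / δ := by
        calc ((min (m - 1) k₀ : ℕ) : ℝ) ≤ (k₀ : ℝ) := by exact_mod_cast min_le_right _ _
          _ ≤ (t - a) / δ := Nat.floor_le hnonneg
      have := mul_le_mul_of_nonneg_right hk hδpos.le
      rw [div_mul_cancel₀ _ hδpos.ne'] at this
      linarith
    · -- upper end
      rcases le_total (m - 1) k₀ with hle | hle
      · rw [min_eq_left hle]
        have hcast : ((m - 1 : ℕ) : ℝ) + 1 = m := by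
          rw [Nat.cast_sub (Nat.one_le_iff_ne_zero.2 hm.ne'), Nat.cast_one, sub_add_cancel]
        rw [hcast]
        exact htb
      · rw [min_eq_right hle]
        have hlt : (t - a) / δ < k₀ + 1 := Nat.lt_floor_add_one _
        have := mul_lt_mul_of_pos_right hlt hδpos
        rw [div_mul_cancel₀ _ hδpos.ne'] at this
        linarith

/-- **Window subadditivity of the collision count**: on a hard-sphere trajectory the number of
collisions in `[a, a + m δ]` (`m ≥ 1`) is at most the sum over the `m` windows
`[a + k δ, a + (k+1) δ]`. [folklore] -/
theorem numCollisions_le_sum_windows [TopologicalSpace X] {γ : ℝ → Config N d X}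
    (h : IsHardSphereTrajectory G ε N γ) (a : ℝ) {δ : ℝ} (hδ : 0 ≤ δ) {m : ℕ} (hm : 0 < m) :
    numCollisions G ε γ a (a + m * δ) ≤
      ∑ k ∈ Finset.range m, numCollisions G ε γ (a + k * δ) (a + (k + 1) * δ) := by
  classical
  have hfin := h.locFinite a (a + m * δ)
  have hfink : ∀ k : ℕ, (collisionTimes G ε γ ∩ Icc (a + k * δ) (a + (k + 1) * δ)).Finite :=
    fun k => h.locFinite _ _
  have hcover : hfin.toFinset ⊆ (Finset.range m).biUnion fun k => (hfink k).toFinset := by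
    intro t ht
    rw [Set.Finite.mem_toFinset] at ht
    obtain ⟨k, hk, htk⟩ := exists_window_of_mem_Icc hδ hm ht.2
    rw [Finset.mem_biUnion]
    exact ⟨k, Finset.mem_range.2 hk, (Set.Finite.mem_toFinset _).2 ⟨ht.1, htk⟩⟩
  rw [h.numCollisions_eq]
  calc hfin.toFinset.card ≤ ((Finset.range m).biUnion fun k => (hfink k).toFinset).card :=
        Finset.card_le_card hcover
    _ ≤ ∑ k ∈ Finset.range m, (hfink k).toFinset.card := Finset.card_biUnion_le
    _ = ∑ k ∈ Finset.range m, numCollisions G ε γ (a + k * δ) (a + (k + 1) * δ) :=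
        Finset.sum_congr rfl fun k _ => (h.numCollisions_eq _ _).symm

/-- `min (n, M) ≤ Σ_k min (n_k, M)` whenever `n ≤ Σ_k n_k` (naturals). [folklore] -/
theorem min_le_sum_min {ι : Type*} (s : Finset ι) (n : ι → ℕ) {total M : ℕ}
    (h : total ≤ ∑ k ∈ s, n k) : min total M ≤ ∑ k ∈ s, min (n k) M := by
  by_cases hbig : ∃ k ∈ s, M ≤ n k
  · obtain ⟨k, hk, hMk⟩ := hbig
    calc min total M ≤ M := min_le_right _ _
      _ = min (n k) M := (min_eq_right hMk).symm
      _ ≤ ∑ k ∈ s, min (n k) M :=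
          Finset.single_le_sum (f := fun k => min (n k) M) (fun _ _ => Nat.zero_le _) hk
  · push Not at hbig
    calc min total M ≤ total := min_le_left _ _
      _ ≤ ∑ k ∈ s, n k := h
      _ = ∑ k ∈ s, min (n k) M := Finset.sum_congr rfl fun k hk => (min_eq_left (hbig k hk).le).symm

/-- `min (n, M) ≤ 𝟙[n ≥ 1] + (M - 1)·𝟙[n ≥ 2]` for naturals, `M ≥ 1`, in `ℝ≥0∞`. [folklore] -/
theorem min_le_indicator_add (n : ℕ) {M : ℕ} (hM : 1 ≤ M) :
    ((min n M : ℕ) : ℝ≥0∞) ≤ (if 1 ≤ n then 1 else 0) + (M - 1 : ℕ) * (if 2 ≤ n then 1 else 0) := by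
  rcases Nat.lt_or_ge n 1 with h0 | h1
  · have : n = 0 := Nat.lt_one_iff.1 h0
    subst this
    simp
  rcases Nat.lt_or_ge n 2 with h1' | h2
  · have : n = 1 := le_antisymm (Nat.lt_succ_iff.1 h1') h1
    subst this
    simp [min_eq_left hM]
  · rw [if_pos h1, if_pos h2, mul_one]
    have : min n M ≤ 1 + (M - 1) := by omega
    exact_mod_cast this

/-- **Flow shift of the collision count**: along a hard-sphere flow, on the good set, the collisions
of the orbit of `Φ_t z` in `[a, b]` are those of the orbit of `z` in `[a + t, b + t]`. [folklore] -/
theorem numCollisions_flow_shift [MeasureSpace X] [TopologicalSpace X] (Φ : HardSphereFlow G ε N)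
    {z : Config N d X} (hz : z ∈ Φ.good) (t a b : ℝ) :
    numCollisions G ε (fun s => Φ.flow s (Φ.flow t z)) a b =
      numCollisions G ε (fun s => Φ.flow s z) (a + t) (b + t) := by
  have horbit : (fun s => Φ.flow s (Φ.flow t z)) = fun s => Φ.flow (s + t) z := by
    funext s
    rw [Φ.flow_add s t z hz]
  have hset : collisionTimes G ε (fun s => Φ.flow s (Φ.flow t z)) ∩ Icc a b =
      (fun s => s + t) ⁻¹' (collisionTimes G ε (fun s => Φ.flow s z) ∩ Icc (a + t) (b + t)) := by
    ext s
    simp only [horbit, mem_inter_iff, mem_preimage, mem_collisionTimes, mem_Icc, add_le_add_iff_right]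
  rw [numCollisions, numCollisions, hset]
  have hbij : (collisionTimes G ε (fun s => Φ.flow s z) ∩ Icc (a + t) (b + t)) =
      (fun s => s + t) '' ((fun s => s + t) ⁻¹'
        (collisionTimes G ε (fun s => Φ.flow s z) ∩ Icc (a + t) (b + t))) := by
    rw [image_preimage_eq _ (fun y => ⟨y - t, by simp⟩)]
  conv_rhs => rw [hbij]
  rw [Set.ncard_image_of_injective _ (add_left_injective t)]


/-- **Registered helper stub `stub_collisionCountMeasurable`** of crux stmt-AtomisticToContinuum-13078
(rung-0 collision-count bound, part 1: the collision count of the orbit, extended by `0` off the good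
set, is measurable in the initial datum; = `measurable_indicator_numCollisions` in signature form).
[folklore] -/
theorem stub_collisionCountMeasurable :
    ∀ (N : ℕ) (ε : ℝ), ε < 2⁻¹ → ∀ (Φ : HardSphereFlow (Torus.geometry (Fin 3)) ε N) (a b : ℝ), Measurable (Φ.good.indicator fun z => (numCollisions (Torus.geometry (Fin 3)) ε (fun s => Φ.flow s z) a b : ℝ≥0∞)) :=
  fun _N _ε hε2 Φ a b => measurable_indicator_numCollisions hε2 Φ a b

end Summit.AtomisticToContinuum.HydrodynamicLimit.Theorems

end
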